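import Summits.CriticalPhenomena.PercolationContinuityZ3.Theorems.Transplant.FKConnectivityAllQPat3KNetDefs
import HarnessLib

/-!
# Connectivity correlation inequalities for `φ_{w,q}`, every `q > 0` — the class 𝒦: a bridge IN PARALLEL, viewed at a slot

Helper file (`--supports stmt-CriticalPhenomena-4575`), census lineage (gen 41) of LANE 2's FK sub-programme; builds on p205010 (kernel
theorem, internal audit signed; external expert review pending).  No definitions, no named facts, no sorries; standard axioms.

THEOREM SP(𝒦)'s inner recursion decomposes one side `E₁` of a parallel composition `N = E₁ ∥ E₂` (between `a, b`, both sides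
𝒦-networks).  When `E₁ = BRIDGE(Qac, Qad, Qbc, Qbd, Qcd; a, b)` the whole `N` is a `K₄` with six 𝒦-slots, `E₂` being the slot `ab`;
seen from the ends of a slot `e` of the bridge, `N = Q_e ∥ BRIDGE'` where `BRIDGE'` is the bridge on the ends of `e` whose fifth slot is
`E₂` — so the recursion continues with the strictly smaller side `Q_e` (census g41 memo §6 (c), drafts/README).  This file builds
`BRIDGE'` and the parallel-composition data for the slot `cd` (`FK.bridgePar_view_cd`) and the slot `ac` (`FK.bridgePar_view_ac`);
the slots `ad`, `bc`, `bd` follow by `FK.BridgeSep.swap_cd` / `FK.BridgeSep.symm` exactly as in «Pat3KNetViews».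
[cite: AyyerLinussonRavichandran2025, §7 (p. 22)] [cite: Grimmett2006, §3.9 (pp. 63–64)]
-/

namespace Summit.CriticalPhenomena.PercolationContinuityZ3.Theorems

namespace FK

open scoped Classical

variable {V : Type*} {Qac Qad Qbc Qbd Qcd E₂ : Finset (Sym2 V)} {a b c d : V}

/-- Separation of a bridge `E₁` (poles `a, b`) from a parallel part `E₂`, restricted to one slot of the bridge. [folklore] -/
theorem sep_slot_of_sep {Q E₁ : Finset (Sym2 V)} (hQ : Q ⊆ E₁)
    (hV : ∀ z : V, (∃ e ∈ E₁, z ∈ e) → (∃ e ∈ E₂, z ∈ e) → z = a ∨ z = b) :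
    ∀ z : V, (∃ e ∈ Q, z ∈ e) → (∃ e ∈ E₂, z ∈ e) → z = a ∨ z = b :=
  fun z ⟨e, he, hze⟩ h₂ => hV z ⟨e, hQ he, hze⟩ h₂

/-- **The bridge completed by the parallel part, re-rooted at `c, d`, satisfies the bridge side conditions**: slots
`(Qca, Qcb, Qda, Qdb, E₂)` on poles `c, d` with inner vertices `a, b`. [folklore] -/
theorem bridgeSep_par_cd (hac : IsKNet Qac a c) (had : IsKNet Qad a d) (hbc : IsKNet Qbc b c) (hbd : IsKNet Qbd b d)
    (hsep : BridgeSep Qac Qad Qbc Qbd Qcd a b c d) (hd : Disjoint (Qac ∪ Qad ∪ Qbc ∪ Qbd ∪ Qcd) E₂)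
    (hV : ∀ z : V, (∃ e ∈ Qac ∪ Qad ∪ Qbc ∪ Qbd ∪ Qcd, z ∈ e) → (∃ e ∈ E₂, z ∈ e) → z = a ∨ z = b) :
    BridgeSep Qac Qbc Qad Qbd E₂ c d a b := by
  have sac : Qac ⊆ Qac ∪ Qad ∪ Qbc ∪ Qbd ∪ Qcd := fun e he => by simp only [Finset.mem_union]; exact Or.inl (Or.inl (Or.inl (Or.inl he)))
  have sad : Qad ⊆ Qac ∪ Qad ∪ Qbc ∪ Qbd ∪ Qcd := fun e he => by simp only [Finset.mem_union]; exact Or.inl (Or.inl (Or.inl (Or.inr he)))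
  have sbc : Qbc ⊆ Qac ∪ Qad ∪ Qbc ∪ Qbd ∪ Qcd := fun e he => by simp only [Finset.mem_union]; exact Or.inl (Or.inl (Or.inr he))
  have sbd : Qbd ⊆ Qac ∪ Qad ∪ Qbc ∪ Qbd ∪ Qcd := fun e he => by simp only [Finset.mem_union]; exact Or.inl (Or.inr he)
  have hbac : ¬ ∃ e ∈ Qac, b ∈ e := fun h => hbc.ne (hsep.v_ac_bc b h hbc.left_mem)
  have habc : ¬ ∃ e ∈ Qbc, a ∈ e := fun h => hac.ne (hsep.v_ac_bc a hac.left_mem h)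
  have hbad : ¬ ∃ e ∈ Qad, b ∈ e := fun h => hbd.ne (hsep.v_ad_bd b h hbd.left_mem)
  have habd : ¬ ∃ e ∈ Qbd, a ∈ e := fun h => had.ne (hsep.v_ad_bd a had.left_mem h)
  exact
  { d_ac_ad := hsep.d_ac_bc
    d_ac_bc := hsep.d_ac_ad
    d_ac_bd := hsep.d_ac_bd
    d_ac_cd := Finset.disjoint_of_subset_left sac hd
    d_ad_bc := hsep.d_ad_bc.symm
    d_ad_bd := hsep.d_bc_bd
    d_ad_cd := Finset.disjoint_of_subset_left sbc hd
    d_bc_bd := hsep.d_ad_bd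
    d_bc_cd := Finset.disjoint_of_subset_left sad hd
    d_bd_cd := Finset.disjoint_of_subset_left sbd hd
    v_ac_ad := hsep.v_ac_bc
    v_ac_bc := hsep.v_ac_ad
    v_ac_bd := hsep.v_ac_bd
    v_ac_cd := fun z h h₂ => (sep_slot_of_sep sac hV z h h₂).elim id fun hz => absurd (hz ▸ h) hbac
    v_ad_bc := fun z h h' => hsep.v_ad_bc z h' h
    v_ad_bd := hsep.v_bc_bd
    v_ad_cd := fun z h h₂ => (sep_slot_of_sep sbc hV z h h₂).elim (fun hz => absurd (hz ▸ h) habc) id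
    v_bc_bd := hsep.v_ad_bd
    v_bc_cd := fun z h h₂ => (sep_slot_of_sep sad hV z h h₂).elim id fun hz => absurd (hz ▸ h) hbad
    v_bd_cd := fun z h h₂ => (sep_slot_of_sep sbd hV z h h₂).elim (fun hz => absurd (hz ▸ h) habd) id }

/-- **VIEW OF `BRIDGE ∥ E₂` AT THE SLOT `cd`**: `E₁ ∪ E₂ = Qcd ∪ B'` with `B' = Qac ∪ Qbc ∪ Qad ∪ Qbd ∪ E₂` a 𝒦-network (a bridge)
between `c` and `d`, edge-disjoint from `Qcd` and meeting it inside `{c, d}` — the data `FK.typeIK_good` & co. recurse on. [folklore] -/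
theorem bridgePar_view_cd (hac : IsKNet Qac a c) (had : IsKNet Qad a d) (hbc : IsKNet Qbc b c) (hbd : IsKNet Qbd b d)
    (hsep : BridgeSep Qac Qad Qbc Qbd Qcd a b c d) (h₂ : IsKNet E₂ a b)
    (hd : Disjoint (Qac ∪ Qad ∪ Qbc ∪ Qbd ∪ Qcd) E₂)
    (hV : ∀ z : V, (∃ e ∈ Qac ∪ Qad ∪ Qbc ∪ Qbd ∪ Qcd, z ∈ e) → (∃ e ∈ E₂, z ∈ e) → z = a ∨ z = b) :
    Qac ∪ Qad ∪ Qbc ∪ Qbd ∪ Qcd ∪ E₂ = Qcd ∪ (Qac ∪ Qbc ∪ Qad ∪ Qbd ∪ E₂) ∧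
      IsKNet (Qac ∪ Qbc ∪ Qad ∪ Qbd ∪ E₂) c d ∧ Disjoint Qcd (Qac ∪ Qbc ∪ Qad ∪ Qbd ∪ E₂) ∧
      (∀ z : V, (∃ e ∈ Qcd, z ∈ e) → (∃ e ∈ Qac ∪ Qbc ∪ Qad ∪ Qbd ∪ E₂, z ∈ e) → z = c ∨ z = d) := by
  have scd : Qcd ⊆ Qac ∪ Qad ∪ Qbc ∪ Qbd ∪ Qcd := fun e he => Finset.mem_union_right _ he
  have hacd : ¬ ∃ e ∈ Qcd, a ∈ e := fun h => hac.ne (hsep.v_ac_cd a hac.left_mem h)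
  have hbcd : ¬ ∃ e ∈ Qcd, b ∈ e := fun h => hbc.ne (hsep.v_bc_cd b hbc.left_mem h)
  refine ⟨by ac_rfl, IsKNet.bridge hac.symm hbc.symm had.symm hbd.symm h₂ (bridgeSep_par_cd hac had hbc hbd hsep hd hV), ?_, ?_⟩
  · exact Finset.disjoint_union_right.2 ⟨Finset.disjoint_union_right.2 ⟨Finset.disjoint_union_right.2
      ⟨Finset.disjoint_union_right.2 ⟨hsep.d_ac_cd.symm, hsep.d_bc_cd.symm⟩, hsep.d_ad_cd.symm⟩, hsep.d_bd_cd.symm⟩,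
      Finset.disjoint_of_subset_left scd hd⟩
  · intro z hz₁ hz₂
    obtain ⟨f, hf, hzf⟩ := hz₂
    simp only [Finset.mem_union] at hf
    rcases hf with (((hf | hf) | hf) | hf) | hf
    · exact Or.inl (hsep.v_ac_cd z ⟨f, hf, hzf⟩ hz₁)
    · exact Or.inl (hsep.v_bc_cd z ⟨f, hf, hzf⟩ hz₁)
    · exact Or.inr (hsep.v_ad_cd z ⟨f, hf, hzf⟩ hz₁)
    · exact Or.inr (hsep.v_bd_cd z ⟨f, hf, hzf⟩ hz₁)
    · rcases sep_slot_of_sep scd hV z hz₁ ⟨f, hf, hzf⟩ with h | h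
      · exact absurd (h ▸ hz₁) hacd
      · exact absurd (h ▸ hz₁) hbcd

/-- **The bridge completed by the parallel part, re-rooted at `a, c`**: slots `(E₂, Qad, Qcb, Qcd, Qbd)` on poles `a, c` with inner
vertices `b, d` satisfy the bridge side conditions. [folklore] -/
theorem bridgeSep_par_ac (hac : IsKNet Qac a c) (had : IsKNet Qad a d) (hbc : IsKNet Qbc b c) (hbd : IsKNet Qbd b d)
    (hsep : BridgeSep Qac Qad Qbc Qbd Qcd a b c d)
    (hd : Disjoint (Qac ∪ Qad ∪ Qbc ∪ Qbd ∪ Qcd) E₂)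
    (hV : ∀ z : V, (∃ e ∈ Qac ∪ Qad ∪ Qbc ∪ Qbd ∪ Qcd, z ∈ e) → (∃ e ∈ E₂, z ∈ e) → z = a ∨ z = b) :
    BridgeSep E₂ Qad Qbc Qcd Qbd a c b d := by
  have sad : Qad ⊆ Qac ∪ Qad ∪ Qbc ∪ Qbd ∪ Qcd := fun e he => by simp only [Finset.mem_union]; exact Or.inl (Or.inl (Or.inl (Or.inr he)))
  have sbc : Qbc ⊆ Qac ∪ Qad ∪ Qbc ∪ Qbd ∪ Qcd := fun e he => by simp only [Finset.mem_union]; exact Or.inl (Or.inl (Or.inr he))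
  have sbd : Qbd ⊆ Qac ∪ Qad ∪ Qbc ∪ Qbd ∪ Qcd := fun e he => by simp only [Finset.mem_union]; exact Or.inl (Or.inr he)
  have scd : Qcd ⊆ Qac ∪ Qad ∪ Qbc ∪ Qbd ∪ Qcd := fun e he => Finset.mem_union_right _ he
  have hbad : ¬ ∃ e ∈ Qad, b ∈ e := fun h => hbd.ne (hsep.v_ad_bd b h hbd.left_mem)
  have habc : ¬ ∃ e ∈ Qbc, a ∈ e := fun h => hac.ne (hsep.v_ac_bc a hac.left_mem h)
  have hacd : ¬ ∃ e ∈ Qcd, a ∈ e := fun h => hac.ne (hsep.v_ac_cd a hac.left_mem h)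
  have hbcd : ¬ ∃ e ∈ Qcd, b ∈ e := fun h => hbc.ne (hsep.v_bc_cd b hbc.left_mem h)
  have habd : ¬ ∃ e ∈ Qbd, a ∈ e := fun h => had.ne (hsep.v_ad_bd a had.left_mem h)
  exact
  { d_ac_ad := (Finset.disjoint_of_subset_left sad hd).symm
    d_ac_bc := (Finset.disjoint_of_subset_left sbc hd).symm
    d_ac_bd := (Finset.disjoint_of_subset_left scd hd).symm
    d_ac_cd := (Finset.disjoint_of_subset_left sbd hd).symm
    d_ad_bc := hsep.d_ad_bc
    d_ad_bd := hsep.d_ad_cd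
    d_ad_cd := hsep.d_ad_bd
    d_bc_bd := hsep.d_bc_cd
    d_bc_cd := hsep.d_bc_bd
    d_bd_cd := hsep.d_bd_cd.symm
    v_ac_ad := fun z h₂ h => (sep_slot_of_sep sad hV z h h₂).elim id fun hz => absurd (hz ▸ h) hbad
    v_ac_bc := fun z h₂ h => (sep_slot_of_sep sbc hV z h h₂).elim (fun hz => absurd (hz ▸ h) habc) id
    v_ac_bd := fun z h₂ h => (sep_slot_of_sep scd hV z h h₂).elim (fun hz => hacd (hz ▸ h)) fun hz => hbcd (hz ▸ h)
    v_ac_cd := fun z h₂ h => (sep_slot_of_sep sbd hV z h h₂).elim (fun hz => absurd (hz ▸ h) habd) id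
    v_ad_bc := hsep.v_ad_bc
    v_ad_bd := hsep.v_ad_cd
    v_ad_cd := hsep.v_ad_bd
    v_bc_bd := hsep.v_bc_cd
    v_bc_cd := hsep.v_bc_bd
    v_bd_cd := fun z h h' => hsep.v_bd_cd z h' h }

/-- **VIEW OF `BRIDGE ∥ E₂` AT THE SLOT `ac`**: `E₁ ∪ E₂ = Qac ∪ B''` with `B'' = E₂ ∪ Qad ∪ Qbc ∪ Qcd ∪ Qbd` a 𝒦-network (a bridge)
between `a` and `c`, edge-disjoint from `Qac` and meeting it inside `{a, c}`. [folklore] -/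
theorem bridgePar_view_ac (hac : IsKNet Qac a c) (had : IsKNet Qad a d) (hbc : IsKNet Qbc b c) (hbd : IsKNet Qbd b d)
    (hcd : IsKNet Qcd c d) (hsep : BridgeSep Qac Qad Qbc Qbd Qcd a b c d) (h₂ : IsKNet E₂ a b)
    (hd : Disjoint (Qac ∪ Qad ∪ Qbc ∪ Qbd ∪ Qcd) E₂)
    (hV : ∀ z : V, (∃ e ∈ Qac ∪ Qad ∪ Qbc ∪ Qbd ∪ Qcd, z ∈ e) → (∃ e ∈ E₂, z ∈ e) → z = a ∨ z = b) :
    Qac ∪ Qad ∪ Qbc ∪ Qbd ∪ Qcd ∪ E₂ = Qac ∪ (E₂ ∪ Qad ∪ Qbc ∪ Qcd ∪ Qbd) ∧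
      IsKNet (E₂ ∪ Qad ∪ Qbc ∪ Qcd ∪ Qbd) a c ∧ Disjoint Qac (E₂ ∪ Qad ∪ Qbc ∪ Qcd ∪ Qbd) ∧
      (∀ z : V, (∃ e ∈ Qac, z ∈ e) → (∃ e ∈ E₂ ∪ Qad ∪ Qbc ∪ Qcd ∪ Qbd, z ∈ e) → z = a ∨ z = c) := by
  have sac : Qac ⊆ Qac ∪ Qad ∪ Qbc ∪ Qbd ∪ Qcd := fun e he => by simp only [Finset.mem_union]; exact Or.inl (Or.inl (Or.inl (Or.inl he)))
  have hbac : ¬ ∃ e ∈ Qac, b ∈ e := fun h => hbc.ne (hsep.v_ac_bc b h hbc.left_mem)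
  refine ⟨by ac_rfl, IsKNet.bridge h₂ had hbc.symm hcd hbd (bridgeSep_par_ac hac had hbc hbd hsep hd hV), ?_, ?_⟩
  · exact Finset.disjoint_union_right.2 ⟨Finset.disjoint_union_right.2 ⟨Finset.disjoint_union_right.2
      ⟨Finset.disjoint_union_right.2 ⟨Finset.disjoint_of_subset_left sac hd, hsep.d_ac_ad⟩, hsep.d_ac_bc⟩, hsep.d_ac_cd⟩,
      hsep.d_ac_bd⟩
  · intro z hz₁ hz₂
    obtain ⟨f, hf, hzf⟩ := hz₂
    simp only [Finset.mem_union] at hf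
    rcases hf with (((hf | hf) | hf) | hf) | hf
    · rcases sep_slot_of_sep sac hV z hz₁ ⟨f, hf, hzf⟩ with h | h
      · exact Or.inl h
      · exact absurd (h ▸ hz₁) hbac
    · exact Or.inl (hsep.v_ac_ad z hz₁ ⟨f, hf, hzf⟩)
    · exact Or.inr (hsep.v_ac_bc z hz₁ ⟨f, hf, hzf⟩)
    · exact Or.inr (hsep.v_ac_cd z hz₁ ⟨f, hf, hzf⟩)
    · exact (hsep.v_ac_bd z hz₁ ⟨f, hf, hzf⟩).elim

/-- The side `Q_cd` of the view is strictly smaller than the bridge (the measure of the inner recursion drops). [folklore] -/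
theorem card_cd_lt_bridge (hac : IsKNet Qac a c) (hsep : BridgeSep Qac Qad Qbc Qbd Qcd a b c d) :
    Qcd.card < (Qac ∪ Qad ∪ Qbc ∪ Qbd ∪ Qcd).card := by
  have h1 : Qac ∪ Qcd ⊆ Qac ∪ Qad ∪ Qbc ∪ Qbd ∪ Qcd := by
    intro e he
    rcases Finset.mem_union.1 he with h | h
    · exact Finset.mem_union_left _ (Finset.mem_union_left _ (Finset.mem_union_left _ (Finset.mem_union_left _ h)))
    · exact Finset.mem_union_right _ h
  have h2 := Finset.card_le_card h1
  rw [Finset.card_union_of_disjoint hsep.d_ac_cd] at h2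
  have := hac.card_pos
  omega

/-- The side `Q_ac` of the view is strictly smaller than the bridge. [folklore] -/
theorem card_ac_lt_bridge (hcd : IsKNet Qcd c d) (hsep : BridgeSep Qac Qad Qbc Qbd Qcd a b c d) :
    Qac.card < (Qac ∪ Qad ∪ Qbc ∪ Qbd ∪ Qcd).card := by
  have h1 : Qac ∪ Qcd ⊆ Qac ∪ Qad ∪ Qbc ∪ Qbd ∪ Qcd := by
    intro e he
    rcases Finset.mem_union.1 he with h | h
    · exact Finset.mem_union_left _ (Finset.mem_union_left _ (Finset.mem_union_left _ (Finset.mem_union_left _ h)))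
    · exact Finset.mem_union_right _ h
  have h2 := Finset.card_le_card h1
  rw [Finset.card_union_of_disjoint hsep.d_ac_cd] at h2
  have := hcd.card_pos
  omega

end FK

end Summit.CriticalPhenomena.PercolationContinuityZ3.Theorems
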